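import Mathlib
import HarnessLib
import HarnessLib.Audit
import Summits.RiemannHypothesis.Statement
import Summits.RiemannHypothesis.RiemannHypothesis.Theorems.SemilocalClassLawLeaves
import Summits.RiemannHypothesis.RiemannHypothesis.Theorems.HandoffDodgerZeroSumReduction
import HarnessLib.Audit.Status.Attr

/-!
Route: WeilSemilocal

CLOSED (proved) 2026-08-26T23:00:00Z by operator:999:14804 — reason: proved:Summit.RiemannHypothesis.RiemannHypothesis.Theorems.WeilSemilocalRoute.semilocalClassLawAll_proof. The file is kept as the record of this route; refuted decls are indexed as negative knowledge (`ledger negatives`).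

# Route WeilSemilocal — W-P(P2) rung leaf — the semilocal class law C-I(a) at every prime: kernel
head, wall rows, two certified-wall campaigns (157 ≤ q < 10⁴ and 10⁴ ≤ q < 6·10⁴) and the RH-free
zero-dodger tail from 60 000

RUNG-LEAF CLOSER (LADDER-RH column WEIL, rung W-P(P2); D-0059 / D-0061; RH-FREE — nothing here bears
on the truth of RH). The leaf is the
tree constant `SemilocalClassLaw.SemilocalClassLawAll` (p405674): for every prime q and every prime
q' > q the truncated Weil form keeping
exactly the primes < q has threshold a*(S_q) = `weilSemilocalThreshold (Nat.primesBelow q)` < (log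
q')/2 (C-I(a), the semilocal class law;
equivalently one inequality per prime, a*(S_q) < (log q⁺)/2,
`semilocalClassLawAll_iff_forall_upperClause`).
It suffices to show X = the conjunction of FIVE RANGE PIECES of that one sentence (regime
decomposition; every piece is the leaf restricted to a
range of q, typed verbatim over tree constants — no new object, no RH door): HEAD q < 80 (support;
PROVED in the tree as
`SemilocalClassLaw.semilocalClassLawHead_holds`, p409205, 22 kernel certificates) ∧ ROWS 80 ≤ q <
157 (support; 9 of the 14 rows are landed
kernel theorems) ∧ WALLS-I 157 ≤ q < 10⁴ (crux 3; 1 193 primes, one kernel negativity certificate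
each — FAST twin-atom cells) ∧ WALLS-II
10⁴ ≤ q < 6·10⁴ (crux 2; 4 828 primes, 606 of them twins — kernel cells at the 10³-prime scale, or
ONE theorem: idea-2's typed theta wall law
`ThetaUpperClauseLogGap` with explicit constants; data: all 4 828 certified two-engine at the THETA
label, exact rational arithmetic, 0 kernel)
∧ TAIL q ≥ 6·10⁴ (support; literally the statement of `Handoff.classLaw_from_sixtyThousand` —
ATTEMPT-21: the mollified zero-dodger zero-sum
family `Handoff.SubwindowZeroSumFamily (1/5) 60000` gives UC(q) at every prime q ≥ 60 000 through
the family's own window clause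
(`wallOffset_lt_of_translatePair`); p410077 pending, its parts p408966 / p409063 / p409399 / p409336
/ p409560 accepted).
rev 1 (ATTEMPT-21 re-cut, 2026-08-25): the rev-0 dodger crux `Handoff.SubwindowZeroSumFamily (7/100)
10000` is retired to an ASIDE (not refuted:
rate 7/100 is dischargeable by the tree's explicit bookkeeping only from q ≈ 10¹⁵ —
handoff-prove-2's audit — and the leaf never needed a rate),
and the rev-0 Assembly node through `SemilocalClassLaw.SemilocalClassLawTail` is dropped, so the
cone of `closes` holds only the five items and
the leaf (staffable the moment the edit lands). No idea card is realised (the route is the column's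
rung, ROUTE-PROPOSAL-WeilSemilocal.md
sha16 69307089d435b95f).
Lean: `SemilocalClassLawHead → SemilocalRowsToOneFiftySeven → SemilocalWallsToTenThousand →
SemilocalWallsToSixtyThousand → SemilocalWallsFromSixtyThousand →
Summit.RiemannHypothesis.RiemannHypothesis.Theorems.SemilocalClassLaw.SemilocalClassLawAll`

## Assembly
Pure logic, no tree theorem: the Assembly item `Assembly : HEAD → ROWS → WALLS-I → WALLS-II → TAIL →
SemilocalClassLawAll` is the five-way case split
q < 80 / q < 157 / q < 10⁴ / q < 6·10⁴ / q ≥ 6·10⁴ (PROVABLE NOW: 12 lines, planner's Sketch.lean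
farm rc 0 — the first prover files it), and the deciding
theorem is `closes hA hH hR hW hM hT := hA hH hR hW hM hT` — every item a binder, conclusion = the
rung leaf.

CLOSES_TARGET: closes rung W-P(P2) of RiemannHypothesis: Summit.RiemannHypothesis.RiemannHypothesis.Theorems.SemilocalClassLaw.SemilocalClassLawAll (D-0061; not the summit Statement) — the deciding theorem of this route concludes that registered leaf instead of the Statement decl `RiemannHypothesis` (class rung: servable and labelled, never counted as concluding the summit Statement).

Rationale: WHY THIS LINE. The semilocal thresholds a*(S) of Weil's explicit-formula quadratic form restricted
to test functions supported in [−a, a] and to a finite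
set of places S ∋ ∞ (Yoshida1992HermitianForms Prop. 6; ConnesConsani2023 §2.1.2; arXiv:2106.01715
§6; arXiv:2511.22755 §3) obey, by the
cell's first-gap locality theorem, a*(S) = a*(S_q) for q = the least prime missing from S, so C-I(a)
is ONE inequality per prime q, and what any
engine must deliver at q is exactly the upper clause UC(q): a*(S_q) < (log q⁺)/2
(`forall_prime_gt_lt_iff_upperClause`). Two RH-free engines own
complementary regimes and the thesis is their gluing (regime decomposition): (i) KERNEL
CERTIFICATES, a finite computation per prime, in two
tiers keyed by the GAP CLASS of q — TIER 1 (gap ≥ 4, q+2 composite): cc-s2-1's theta checker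
`ThetaTier1Check.check` (J = 16) with ONE soundness
theorem `uc_of_thetaCheck : check r = true → UC(r.q)` (arithmetic layer + analytic layer D1–D8 of
THETA-KERNEL-BLUEPRINT; tree inputs p414433
Poisson majorant, p411028/p412019 theta–Mellin, p413181 zero-sum decay) and data modules of ≈ 330
rows at ≈ 0.45 s/row kernel (MEASURED; director GO,
I l.7328 (A)); TIER 2 (twins, q⁺ = q+2, window log(1+2/q)/2 ≈ 1/q): the theta tier-2 checker
(sine-aware cellwise envelope, integer 2¹⁰⁰ layout,
3-row prototype being timed, no campaign approved) or FAST twin-atom negativity cells through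
`weilSemilocalThreshold_le_of_checkW_fast_sharp` (the
engine of the landed head q < 80 and rows q ≤ 151, e.g. the twin wall q = 107:
`SemilocalPolyWitness.weilSemilocalThreshold_uptoHundredThree_lt_log_hundrednine_half`);
(ii) the ANALYTIC ZERO-DODGER of the HANDOFF track — a mollified cosine polynomial in the
q-subwindow whose truncated zero sums sit below the weighted
collar (explicit formula as `re_weilQuadratic_le_of_zeroSum_le`, zero counting of
Hasanalizade–Shen–Wong arXiv:2102.04663, Stirling): the zero-sum
family `SubwindowZeroSumFamily (1/5) 60000` gives UC(q) at every prime q ≥ 60 000 with no prime-gap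
hypothesis and NO RATE CONDITION
(`Handoff.classLaw_from_sixtyThousand`, p410077 ACCEPTED; the tail item is CLOSED, proved by
`WeilSemilocalRoute.semilocalWallsFromSixtyThousand_proof`, p414781).
Imported areas: interval arithmetic / certified computation (engine i) and classical
explicit-formula analysis with explicit constants (engine ii).
What the line does that prior routes do not: route-RiemannHypothesis-WeilPos decides the SUMMIT
through the RH-equivalent residual `SlackResidualLog2`;
this route has NO RH door — it closes an RH-free rung leaf — and its items are range / gap-class
restrictions of the leaf; the negatives index
(CharacterSumsConreyPositivity, UniversalFactorLaplaceLoophole) is untouched.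

RANKED CRUXES. #2 SemilocalWallsToSixtyThousand (crux, stmt-19096) — C-I(a) at every prime 10⁴ ≤ q <
6·10⁴ (4 828 primes): for every prime q' > q, a*(S_q) < (log q')/2.
SPLIT (gen 1, rev 5, BY GAP CLASS, k = 2): WallsSixtyKTwin (crux, stmt-19185; the 606 lower twins,
(q+2).Prime; TIER 2 — the column's hardest honest open
W-P(P2) piece, kernel-cost-bound not idea-bound; first cell q = 10007, window 9.99·10⁻⁵) +
WallsSixtyKNonTwin (crux, stmt-19186; the 4 222 primes of gap ≥ 4;
TIER 1, ≈ 13 data modules, worst relative margin 0.347 at q = 59743, gap 4) + glue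
WallsSixtyKGapSplit (support, stmt-19187; rendered
`WallsSixtyKTwin → WallsSixtyKNonTwin → SemilocalWallsToSixtyThousand`; PROVABLE NOW in one line by
excluded middle on (q+2).Prime:
`fun hT hN q hq hlo hhi => (em (q + 2).Prime).elim (hT q hq hlo hhi) (hN q hq hlo hhi)`, planner
Sketch.lean farm rc 0). [difficulty: XL = the twin child]
[Yoshida1992HermitianForms, ConnesConsani2023, arXiv:2511.22755, arXiv:2106.01715]
#3 SemilocalWallsToTenThousand (crux, stmt-19395) — C-I(a) at every prime 157 ≤ q < 10⁴ (1 193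
primes). SPLIT (gen 1, rev 4, BY GAP CLASS, k = 2): WallsTenKTwin
(crux, stmt-19172; 193 lower twins from q = 179, window (log 181 − log 179)/2 ≈ 5.6·10⁻³ down to ≈
10⁻⁴; TIER 2 / FAST twin-atom K-cells) + WallsTenKNonTwin
(crux, stmt-19173; 1 000 primes of gap ≥ 4; TIER 1, ≈ 3 data modules) + glue WallsTenKGapSplit
(support, stmt-19174; rendered `WallsTenKTwin → WallsTenKNonTwin →
SemilocalWallsToTenThousand`, the same one-line excluded-middle proof). [difficulty: L]
[Yoshida1992HermitianForms, ConnesConsani2023, arXiv:2511.22755]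
#9 SemilocalRowsToOneFiftySeven (support, stmt-19396) — C-I(a) at the fourteen primes 80 ≤ q < 157:
rows q = 83, 89, 97, 107, 113, 127, 131, 139, 151 are landed kernel
theorems (`SemilocalPolyWitness.weilSemilocalThreshold_upto…_lt_log_…_half`); rows 101, 103, 109,
137, 149 have landed bases / pieces; packaging as cc-s2-1's
`semilocalClassLawBelow_137` pattern (`semilocalClassLawAt_of_eq` + `interval_cases`). NOT SPLIT
(director I l.7331: fourteen rows; 103 and 109 ride TIER 1,
101 / 107 / 137 / 149 are twins — 107 is landed (`…uptoHundredThree_lt_log_hundrednine_half`), 101 /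
137 / 149 close by K-cell Finals on their landed pieces or by TIER 2). [difficulty: provable-now]
#9 SemilocalClassLawHead (support, stmt-19397) — the kernel HEAD q < 80, PROVED:
`SemilocalClassLaw.semilocalClassLawHead_holds` (Theorems/SemilocalClassLawHeadCert.lean,
p409205, accepted; its type is this sentence verbatim) — closed by a one-line theorem with the FQ
type the hour the hub olean exists (cc-s2-1). [difficulty: provable-now]
#9 SemilocalWallsFromSixtyThousand (support, stmt-19097) — C-I(a) at every prime q ≥ 60 000: CLOSED,
proved (`WeilSemilocalRoute.semilocalWallsFromSixtyThousand_proof`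
from `Handoff.classLaw_from_sixtyThousand`, p410077 / p414781).
#1 Assembly (stmt-19095) — CLOSED, proved (`WeilSemilocalRoute.assembly_proof`, p413996).
TRIBUNAL READING (D-0033 conjunct split; the five binders of `closes` are jointly the leaf), filed
as `tribunal_fit` with this edit: ATTACKED conjuncts = the two
wall parents #2 / #3 (one certified-wall campaign in two cost regimes, each split by gap class into
a TIER-1 non-twin child and a TIER-2 twin child); RESIDUAL
(imported, closed BY NAME from landed tree theorems, exempt from T3/T4) = SemilocalClassLawHead,
SemilocalRowsToOneFiftySeven, SemilocalWallsFromSixtyThousand;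
WITNESS (BC5 rung of the twin children's lever, a kernel-decided twin wall outside any known regime
of the leaf) =
`SemilocalPolyWitness.weilSemilocalThreshold_uptoHundredThree_lt_log_hundrednine_half` (a*(S_107) <
(log 109)/2); method_family = kernel-certified Weil-negativity /
theta-kernel certificates + explicit-formula zero-dodger. Pre-edit tribunal --full on the rendered
draft (gen2): tk=PROVISIONAL.
ASIDE (never staffed, banked context): DodgerFamilyFromTenThousand (stmt-19394) =
`Handoff.SubwindowZeroSumFamily (7/100) 10000` (rev-0 crux 2; plausibly true, not
dischargeable below q ≈ 10¹⁵ by the tree's explicit dodger bookkeeping — handoff-prove-2 ATTEMPT-21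
§1; PROVED from ⌈e^204⌉ as `subwindowZeroSumFamily_exp204`).

TWO-LAYER PLAN. Layer 2 is now FILED for both wall cruxes (the gap-class splits above; no third
layer will be filed — per-row / per-module lemmas attach to a
child with `--supports <Decl>` and never become items). Registered skeletons stay valid as LINES
under the children: SemilocalWallsToSixtyThousand ⇐ stub_rung10007
(= the first twin cell, now under WallsSixtyKTwin) → stub_midTwinsRest → stub_midNonTwins;
SemilocalWallsToTenThousand ⇐ stub_wallBound (∀ prime 157 ≤ q < 10⁴,
wallOffset q < 1/(q+2)) → stub_bridge (`upperClause_of_wallOffset_lt_inv_add_two`, p409363).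
Per-child closers: TIER-1 children through `uc_of_thetaCheck` + data
modules + `SemilocalClassLaw.forall_prime_gt_lt_iff_upperClause`; TIER-2 children cell by cell.

KILL CRITERIA. A kernel theorem `¬ WallsSixtyKTwin`, `¬ WallsSixtyKNonTwin`, `¬ WallsTenKTwin` or `¬
WallsTenKNonTwin` (one prime 157 ≤ q < 6·10⁴ with (log q⁺)/2 ≤ a*(S_q),
certified from the positivity side `weilSemilocalPositivityOn`) — or the same at any prime — closes
the route `refuted:`: it refutes the parent, the leaf itself and
C-I(a). COST overruns are not kills: a twin child whose cells do not fit the build lane stays open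
(honestly XL) while the non-twin children and the rows close;
a loosened constant in one of D1–D8 that fails TIER-1 rows near the worst margin (0.347 at q =
59743) re-opens only those rows (re-certify at J = 24 or move them
to TIER 2), recorded by a `--supports` census, not by a restatement.

NOT DECOMPOSED YET. Inside the twin children: the engine choice per row (theta tier-2 integer layout
at τ = 1/100 where the margin ≥ 0.4, naive layout elsewhere,
FAST twin-atom K-cell as fallback) — decided by the director after cc-s2-1's 3-row prototype timing
(I l.7328 (B)), then attached as `--supports` lemmas, not items;
inside the non-twin children: the module chunking (≈ 330 rows × 0.45 s per module) and the exact
constant ledger of `uc_of_thetaCheck` (D1–D8). SemilocalRowsToOneFiftySeven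
is deliberately unsplit (fourteen rows). The W-P(P3) ceiling leaf
`WeilColumn.SemilocalOneConstantCeiling` (p404930) is NOT an item of this route (an ∃q₀-statement
cannot bear on the P2 leaf); its own thin route is packaged separately this session (BC1–BC10 +
tribunal kernel, or an honest found-nothing).

CHEAPEST FALSIFIER. TIER 1: elaborate ONE data module containing the worst-margin row q = 59743 (gap
4, relative margin 0.347 at J = 16) against `uc_of_thetaCheck`'s
final constants — if it fails, the tight end of WallsSixtyKNonTwin re-opens and the constant ledger,
not the thesis, is wrong. TIER 2: ONE twin cell at q = 10007
(q⁺ = 10009, window 9.99·10⁻⁵; ≈ 1 230 primes' atoms) — if neither the tier-2 theta layout nor a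
FAST K-cell certifies it within the lane's budget, the twin
children are dead at the door as a campaign (they stay true-in-data: 799/799 twins THETA-certified
two-engine) and become theorem-only (idea-2's theta wall law
`ThetaUpperClauseLogGap`). Lookups done: every landed row q ≤ 151 passes with margin (δ*(113) ≤
0.0153 vs window 0.058), all 6 021 primes 157 ≤ q < 6·10⁴ are
THETA-certified in exact rational arithmetic, and RH predicts δ*(q) ≥ 0 only — no counter-indication
anywhere.

NUMBERS. Kernel head: 22 certificates, q < 80 (p402719; `semilocalClassLawHead_holds` p409205).
Landed rows ≥ 80: 83, 89, 97, 107, 113 (δ* ≤ 0.0153), 127 (δ* ≤ 0.0135),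
131 (δ* ≤ 0.0194), 139, 151; pending 101, 103, 109, 137, 149. Crux 3 range [157, 10⁴): 1 193 primes
= 193 twins (first 179) + 1 000 of gap ≥ 4. Crux 2 range
[10⁴, 6·10⁴): 4 828 primes = 606 twins (first 10007) + 4 222 of gap ≥ 4 (605 of gap 4, 3 617 of gap
≥ 6). TIER 1: 5 222 non-twin rows in [157, 6·10⁴), all PASS
`check` at J = 16 in the Python twin, ≈ 0.45 s/row kernel, ≈ 16 modules; worst relative margin 0.347
(q = 59743). TIER 2: 799 twin rows, model 2–4 min/row naive,
≈ 10 s/row at τ = 1/100. Tail: `SubwindowZeroSumFamily (1/5) 60000` (p410077), item closed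
(p414781). Necessary per prime: δ*(q) < (log q⁺ − log q)/2; sufficient:
wallOffset q < 1/(q+2). FAST Finals at q ≤ 151 run 60–430 s on the farm.

DEFINITION REQUESTS. None: every constant exists (`weilSemilocalThreshold`, `Nat.primesBelow`,
`Nat.Prime`, `Real.log`, `SemilocalClassLaw.SemilocalClassLawAll` —
`lean search --decl` confirmed; the four child statements elaborate in the planner's Sketch.lean,
farm rc 0).

Novelty: Searches (2026-08-25): lit search --hybrid "Weil explicit formula positivity finitely many places
semilocal threshold support" (10 docs: arXiv:2511.22755 pp 5/9/33, galaxy-pdf-4005501466549090220 =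
Bombieri 2000 pp 2/4/34, galaxy-pdf-5018474040 = Connes 1999 pp 1/5/39, rest off-topic); lit vsearch
"<threshold of the support length … as a function of the set of primes>" --papers (2 off-topic
hits); lit search "Yoshida Hermitian forms attached zeta functions" --source local (6:
yoshida2018-hermitian-forms-attached-zeta-functions pp 1/37/45, arXiv:2106.01715 p22,
arXiv:2206.03682, arXiv:2209.04658, …); lit galaxy search "semilocal trace formula|semi-local trace
formula|Weil positivity" --star all (panama 3: Jia–Matsumoto 504426729046016, van Frankenhuijsen
328109731610713, Terras; pdf 0; crabby 0); lit galaxy search "Weil's explicit formula|Weil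
positivity|semi-local trace" --star pdf (10: Connes essay pdf:4318080820, Berry–Keating,
Fiorilli–Miller, …); ledger negatives --problem RiemannHypothesis (2, unrelated); lean search
weilSemilocalThreshold (tree only).
Nearest prior art found: Yoshida1992HermitianForms Prop. 6
[corpus:yoshida2018-hermitian-forms-attached-zeta-functions p.40, confirmed `lit read --grep
'Proposition 6'`] (the threshold a₀ of the FULL set of places: positive (semi-)definite for a ≤ a₀,
not for a > a₀); arXiv:2106.01715 §6 and arXiv:2511.22755 §3.2 [corpus:arxiv-2511.22755 pp.10–11,
Prop. 3.3 / Thm 3.6, confirmed `lit read --grep semilocal`] (the x-truncated  [refs: 2511.22755, 2106.01715, 2206.03682, 2209.04658, arxiv-2511.22755]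

Barriers (technique_class: certified-weil-negativity, explicit-formula-dodger): - technique_class: certified-weil-negativity, explicit-formula-dodger
- SemilocalCutoffInnerCriterion (file
Literature/Barriers/RiemannHypothesis/SemilocalCutoffInnerCriterion.lean; its decl is not yet in the
gate barrier index at filing, so cited by file): outside its class — that entry kills Li's
positive-operator identity `P u*(1−P) u P = −½u⁻¹đu` as a route TO semilocal positivity; our cruxes
assert the failure of positivity beyond a*(S_q) by explicit test vectors / dodgers under the support
condition and never use the cutoff operator (the entry's own evasions_known names computer-assisted
finite-section certificates).
- Literature.Barriers.RiemannHypothesis.FiniteCarrierNoOrbitAtoms: outside — no finite-dimensional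
flow carrier or dynamical cohomology is posited; the statements are inequalities between ζ's zeros
(explicit formula) and actual primes.
- Literature.Barriers.RiemannHypothesis.DiamondMontgomeryVorhauer2006_thm1: (file
BeurlingCounterexamples.lean) outside — not a zero-free-region / PNT-remainder argument from N(x) =
κx + O(x^θ); the certificates and the dodger use the actual primes below q and the functional
equation of ζ itself (a Beurling system has other thresholds).
- Literature.Barriers.RiemannHypothesis.MollifierLimitations: outside — the "mollified" dodger
smooths a cosine polynomial by a bump of radius 1/(q³+1); no mollified MOMENT of ζ and no
proportion-of-zeros or θ = ∞ claim is made (Radziwiłł 2012 / Bettin–Gonek 2017 quantify over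
mollifier length

History (route lifecycle, newest last):
- 2026-08-25T23:59:29Z · rev 2: restated Assembly (stmt-RiemannHypothesis-19398) — rev 2 (ATTEMPT-21 re-cut, part 2 after the rev-1 aside of 19394; director I l.7270/7274, prove-2 I l.7268): ADD crux SemilocalWallsToSixtyThousand (10⁴ ≤ q < 6· (planner-rh-explicit-weil-routes-1-g2-0)
- 2026-08-26T23:00:00Z · CLOSED proved — proved:Summit.RiemannHypothesis.RiemannHypothesis.Theorems.WeilSemilocalRoute.semilocalClassLawAll_proof (operator:999:14804)

sub-problem: RiemannHypothesis · status: closed(proved) · opened planner-rh-explicit-weil-routes-1-g0-0 2026-08-25T21:38:01Z · rev 6 · ledger route-RiemannHypothesis-WeilSemilocal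
GENERATED by the gate from the ledger (D-0016/17). Provers cite these decls: `theorem foo : Summit.RiemannHypothesis.RiemannHypothesis.Theses.WeilSemilocal.<Decl> := …` in Summits/RiemannHypothesis/RiemannHypothesis/Theorems/<Name>.lean.
-/

namespace Summit.RiemannHypothesis.RiemannHypothesis.Theses.WeilSemilocal

open scoped BigOperators Topology Manifold Classical MeasureTheory ProbabilityTheory Matrix InnerProductSpace ComplexConjugate ContinuousMap
open Filter Set Function TopologicalSpace MeasureTheory

attribute [summit_statement] _root_.Summit.RiemannHypothesis
attribute [summit_statement] _root_.Summit.RiemannHypothesis.RiemannHypothesis.Theorems.SemilocalClassLaw.SemilocalClassLawAll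

open Summit

/-- item stmt-RiemannHypothesis-19096 · crux · rank 2 · closed · proved by Summit.RiemannHypothesis.RiemannHypothesis.Theorems.SplitClosure.WeilSemilocal.SemilocalWallsToSixtyThousand_holds @ 2836f4432bb2 (prover) · by planner
why it might fail: a twin prime q in [10⁴, 6·10⁴) with δ*(q) ≥ log(1+2/q)/2 ≈ 1/q (none in THETA data: 606/606 certified); or COST — a FAST cell at q ≈ 10⁴ carries ≈ 1 230 primes' atoms, kernel time unmeasured beyond q = 151 (60–430 s there): ×4 828 may exceed the build lane absent a batch checker or the theta law.
sources: Yoshida1992HermitianForms, ConnesConsani2023, arXiv:2511.22755, arXiv:2106.01715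
[crux] C-I(a) at every prime 10⁴ ≤ q < 6·10⁴ (4 828 primes: 606 twins, 605 of gap 4, 3 617 of gap ≥
6): for every prime q' > q, a*(S_q) = weilSemilocalThreshold (primes < q) < (log q')/2 — the leaf
restricted to the mid-range (the director's «SemilocalMidRangeCells», I l.7270/7274). Engines: one
kernel negativity certificate per prime (FAST twin-atom cells through
`weilSemilocalThreshold_le_of_checkW_fast_sharp`; cost per cell at the 10³-prime scale unmeasured —
the birth skeleton's `stub_rung10007` is the probe), or ONE theorem: idea-2's typed theta wall law
`ThetaUpperClauseLogGap` with explicit constants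
(HOME/handoff/idea-2/gen20/lean/ThetaWallLawSketch.lean). Data: all 4 828 primes THETA-certified
two-engine in exact rational arithmetic (kit j215104, j215561/562; deposit
EXTREMALS/semilocal/Sq-theta-cc6g7-v1), 0 kernel rows. [deps: none] [difficulty: XL] -/
@[route_item "route-RiemannHypothesis-WeilSemilocal", crux]
def SemilocalWallsToSixtyThousand : Prop :=
  ∀ q : ℕ, q.Prime → 10000 ≤ q → q < 60000 → ∀ q' : ℕ, q'.Prime → q < q' → Summit.RiemannHypothesis.RiemannHypothesis.Theorems.MotivicDoor.SemilocalThreshold.weilSemilocalThreshold (Nat.primesBelow q) < Real.log q' / 2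

-- `SemilocalWallsToSixtyThousand` holds: proved by `Summit.RiemannHypothesis.RiemannHypothesis.Theorems.SplitClosure.WeilSemilocal.SemilocalWallsToSixtyThousand_holds` @ 2836f4432bb2 (its module imports this route file, so no `_holds` link can be stated here).

-- parent: SemilocalWallsToSixtyThousand · child (gen 1)
/--     item stmt-RiemannHypothesis-19185 · crux · rank 201 · closed · proved by Summit.RiemannHypothesis.RiemannHypothesis.Theorems.WeilSemilocalRoute.wallsSixtyKTwin_proof (prover)
    parent: SemilocalWallsToSixtyThousand · by planner
    why it might fail: a twin q in [10⁴, 6·10⁴) with δ*(q) ≥ log(1+2/q)/2 ≈ 1/q (none in THETA data, 606/606, but margins untested in the kernel); or COST — 606 rows × 2–4 min naive integer layout ≈ 20–40 h kernel, no approved campaign; τ-coarsening may fail on low-margin rows.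
    sources: Yoshida1992HermitianForms, ConnesConsani2023, arXiv:2511.22755, arXiv:2106.01715
[crux] TWIN child of SemilocalWallsToSixtyThousand (gap class 2, q⁺ = q+2): C-I(a) at the 606
lower-twin primes 10⁴ ≤ q < 6·10⁴ — for every prime q' > q, a*(S_q) < (log q')/2, i.e. δ*(q) <
log(1+2/q)/2 ≈ 1/q ≤ 10⁻⁴ (first cell q = 10007, window (log 10009 − log 10007)/2 ≈ 9.99·10⁻⁵ — the
registered `stub_rung10007`). Engine = TIER 2: the theta tier-2 checker (sine-aware cellwise
envelope, integer 2¹⁰⁰ fixed-point layout; MODEL ≈ 2–4 min/row naive, ≈ 10 s/row with τ coarsened to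
1/100 where the margin ≥ 0.4) once the 3-row prototype is timed and the director rules (I l.7328 (B)
/ 7331 (2)(ii)), or FAST twin-atom K-cells (≈ 1 230 primes' atoms per cell at q ≈ 10⁴; cost
unmeasured). Data: 606/606 certified two-engine at the THETA label (kit j215104 + j215561/562), 0
kernel rows. RH-FREE finite certificates, kernel-cost-bound, not idea-bound — the column's hardest
honest open W-P(P2) piece. [deps: none] [difficulty: XL] -/
@[route_item "route-RiemannHypothesis-WeilSemilocal"]
def WallsSixtyKTwin : Prop :=
  ∀ q : ℕ, q.Prime → 10000 ≤ q → q < 60000 → (q + 2).Prime → ∀ q' : ℕ, q'.Prime → q < q' → Summit.RiemannHypothesis.RiemannHypothesis.Theorems.MotivicDoor.SemilocalThreshold.weilSemilocalThreshold (Nat.primesBelow q) < Real.log q' / 2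

-- `WallsSixtyKTwin` holds: proved by `Summit.RiemannHypothesis.RiemannHypothesis.Theorems.WeilSemilocalRoute.wallsSixtyKTwin_proof` (its module imports this route file, so no `_holds` link can be stated here).

-- parent: SemilocalWallsToSixtyThousand · child (gen 1)
/--     item stmt-RiemannHypothesis-19186 · crux · rank 202 · closed · proved by Summit.RiemannHypothesis.RiemannHypothesis.Theorems.WeilSemilocalRoute.wallsSixtyKNonTwin_proof (prover)
    parent: SemilocalWallsToSixtyThousand · by planner
    why it might fail: `uc_of_thetaCheck` is untyped: if an analytic lemma of D1–D8 lands with a constant looser than the checker's (e.g. arch term, γ ≥ 1/2 enclosure, B-spline majorant), the tight end re-opens — worst kernel margin is only 0.347 at q = 59743 (gap 4), so a 35 % loosening anywhere fails rows.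
    sources: Yoshida1992HermitianForms, ConnesConsani2023, arXiv:2511.22755, RosserSchoenfeld1962
[crux] NON-TWIN child of SemilocalWallsToSixtyThousand (gap class ≥ 4, q+2 composite): C-I(a) at the
4 222 primes 10⁴ ≤ q < 6·10⁴ of gap ≥ 4 — for every prime q' > q, a*(S_q) < (log q')/2. Engine =
TIER 1 (director GO, I l.7328 (A) / 7331 (2)(i)): the soundness theorem `uc_of_thetaCheck : check r
= true → UC(r.q)` for cc-s2-1's theta checker `ThetaTier1Check.check` (J = 16; arithmetic layer +
analytic layer D1–D8 of THETA-KERNEL-BLUEPRINT; tree inputs p414433 Poisson majorant,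
p411028/p412019 theta–Mellin, p413181 zero-sum decay) + ≈ 13 data modules of ≈ 330 rows (≈ 0.45
s/row kernel MEASURED, ≈ 150 s farm per module; worst relative margin 0.347 at q = 59743, gap 4);
closer per row through `SemilocalClassLaw.forall_prime_gt_lt_iff_upperClause`. Data: all 4 222 rows
PASS `check` at J = 16 in the Python twin (THETA-KERNEL-QUOTE §1–2). RH-FREE finite certificates.
[deps: none] [difficulty: M] -/
@[route_item "route-RiemannHypothesis-WeilSemilocal"]
def WallsSixtyKNonTwin : Prop :=
  ∀ q : ℕ, q.Prime → 10000 ≤ q → q < 60000 → ¬ (q + 2).Prime → ∀ q' : ℕ, q'.Prime → q < q' → Summit.RiemannHypothesis.RiemannHypothesis.Theorems.MotivicDoor.SemilocalThreshold.weilSemilocalThreshold (Nat.primesBelow q) < Real.log q' / 2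

-- `WallsSixtyKNonTwin` holds: proved by `Summit.RiemannHypothesis.RiemannHypothesis.Theorems.WeilSemilocalRoute.wallsSixtyKNonTwin_proof` (its module imports this route file, so no `_holds` link can be stated here).

-- parent: SemilocalWallsToSixtyThousand · glue (gen 1)
/--     item stmt-RiemannHypothesis-19187 · support · rank 203 · closed · proved by Summit.RiemannHypothesis.RiemannHypothesis.Theorems.WeilSemilocalRoute.wallsSixtyKGapSplit_proof (prover)
    parent: SemilocalWallsToSixtyThousand · GLUE: children ⟹ parent · by planner
WallsSixtyKNonTwin → WallsSixtyKTwin → SemilocalWallsToSixtyThousand — pure logic, excluded middle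
on `(q+2).Prime`: `fun hN hT q hq hlo hhi => (em (q + 2).Prime).elim (hT q hq hlo hhi) (hN q hq hlo
hhi)` (planner Sketch.lean `semilocalWallsToSixtyThousand_of_gapClass`, farm rc 0 / 0 sorries);
provable now by the first prover in one line. -/
@[route_item "route-RiemannHypothesis-WeilSemilocal"]
def WallsSixtyKGapSplit : Prop :=
  WallsSixtyKTwin → WallsSixtyKNonTwin → SemilocalWallsToSixtyThousand

-- `WallsSixtyKGapSplit` holds: proved by `Summit.RiemannHypothesis.RiemannHypothesis.Theorems.WeilSemilocalRoute.wallsSixtyKGapSplit_proof` (its module imports this route file, so no `_holds` link can be stated here).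

/-- item stmt-RiemannHypothesis-19395 · crux · rank 3 · closed · proved by Summit.RiemannHypothesis.RiemannHypothesis.Theorems.SplitClosure.WeilSemilocal.SemilocalWallsToTenThousand_holds (prover) · by planner
why it might fail: a prime q in [157, 10⁴) with a*(S_q) ≥ (log q⁺)/2 — twin primes demand δ*(q) < log(1+2/q)/2 ≈ 1/q, the tightest rows (δ*(q)·(q+2) ≤ 0.91 measured at 101/107, ≤ 1.6 at 83); or a FAST certificate's dyadic slack exceeding a twin window, forcing a K-cell (10²–10³ core-h) at that prime.
sources: Yoshida1992HermitianForms, ConnesConsani2023, arXiv:2511.22755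
[crux] C-I(a) at every prime 157 ≤ q < 10⁴ (1 193 primes): for every prime q' > q, a*(S_q) < (log
q')/2 — one kernel negativity certificate per prime (FAST twin-atom cells through
`weilSemilocalThreshold_le_of_checkW_fast_sharp`, as rows 113 / 127 / 139 / 151), or any lowering of
crux 2's threshold into this range. [difficulty: L] -/
@[route_item "route-RiemannHypothesis-WeilSemilocal", crux]
def SemilocalWallsToTenThousand : Prop :=
  ∀ q : ℕ, q.Prime → 157 ≤ q → q < 10000 → ∀ q' : ℕ, q'.Prime → q < q' → Summit.RiemannHypothesis.RiemannHypothesis.Theorems.MotivicDoor.SemilocalThreshold.weilSemilocalThreshold (Nat.primesBelow q) < Real.log q' / 2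

-- `SemilocalWallsToTenThousand` holds: proved by `Summit.RiemannHypothesis.RiemannHypothesis.Theorems.SplitClosure.WeilSemilocal.SemilocalWallsToTenThousand_holds` (its module imports this route file, so no `_holds` link can be stated here).

-- parent: SemilocalWallsToTenThousand · child (gen 1)
/--     item stmt-RiemannHypothesis-19172 · crux · rank 301 · closed · proved by Summit.RiemannHypothesis.RiemannHypothesis.Theorems.WeilSemilocalRoute.wallsTenKTwin_proof (prover)
    parent: SemilocalWallsToTenThousand · by planner
    why it might fail: a twin q in [157,10⁴) with δ*(q) ≥ log(1+2/q)/2 ≈ 1/q (tightest measured rows: δ*(q)(q+2) ≤ 0.91 at 101/107; tier-2 min rel. margin 0.088 at q = 461); or per-cell kernel cost — naive ℚ tier-2 port ≈ 1 h/row (refused), integer layout untimed.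
    sources: Yoshida1992HermitianForms, ConnesConsani2023, arXiv:2511.22755, arXiv:2106.01715
[crux] TWIN child of SemilocalWallsToTenThousand (gap class 2, q⁺ = q+2): C-I(a) at the 193
lower-twin primes 157 ≤ q < 10⁴ — for every prime q' > q, a*(S_q) < (log q')/2, i.e. δ*(q) <
log(1+2/q)/2 ≈ 1/q. Engine = TIER 2: FAST twin-atom / K-cell kernel negativity certificates through
`weilSemilocalThreshold_le_of_checkW_fast_sharp` (as rows 101/107), or the theta tier-2 checker
(sine-aware cellwise envelope E1–E5) once an integer-layout prototype is timed and ruled on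
(director I l.7328 (B) / 7331 (2)(ii): prototype only, no campaign yet). Data: all 193 certified
two-engine at the THETA label (deposit EXTREMALS/semilocal/Sq-theta-cc6g7-v1, kit j215104 + twin
seeds j215561/562), 0 kernel rows. RH-FREE finite certificates, kernel-cost-bound, not idea-bound.
[deps: none] [difficulty: L] -/
@[route_item "route-RiemannHypothesis-WeilSemilocal"]
def WallsTenKTwin : Prop :=
  ∀ q : ℕ, q.Prime → 157 ≤ q → q < 10000 → (q + 2).Prime → ∀ q' : ℕ, q'.Prime → q < q' → Summit.RiemannHypothesis.RiemannHypothesis.Theorems.MotivicDoor.SemilocalThreshold.weilSemilocalThreshold (Nat.primesBelow q) < Real.log q' / 2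

-- `WallsTenKTwin` holds: proved by `Summit.RiemannHypothesis.RiemannHypothesis.Theorems.WeilSemilocalRoute.wallsTenKTwin_proof` (its module imports this route file, so no `_holds` link can be stated here).

-- parent: SemilocalWallsToTenThousand · child (gen 1)
/--     item stmt-RiemannHypothesis-19173 · crux · rank 302 · closed · proved by Summit.RiemannHypothesis.RiemannHypothesis.Theorems.WeilSemilocalRoute.wallsTenKNonTwin_proof (prover)
    parent: SemilocalWallsToTenThousand · by planner
    why it might fail: `uc_of_thetaCheck` is untyped: one analytic constant of D1–D8 (B-spline Fourier majorant, arch term at t₀ = 2⁻ᵏ, RS prime-sum tail) may not close as the checker assumes at the small end 157 ≤ q < 10³, where theta tails are largest relative to the (log q⁺ − log q)/2 window.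
    sources: Yoshida1992HermitianForms, ConnesConsani2023, arXiv:2511.22755, RosserSchoenfeld1962
[crux] NON-TWIN child of SemilocalWallsToTenThousand (gap class ≥ 4, q+2 composite): C-I(a) at the 1
000 primes 157 ≤ q < 10⁴ of gap ≥ 4 — for every prime q' > q, a*(S_q) < (log q')/2. Engine = TIER 1
(director GO, I l.7328 (A) / 7331 (2)(i)): ONE soundness theorem `uc_of_thetaCheck : check r = true
→ UC(r.q)` for cc-s2-1's exact-ℚ directed-rounding theta checker `ThetaTier1Check.check` (J = 16;
arithmetic layer `ThetaKernelArith` + analytic layer D1–D8 of THETA-KERNEL-BLUEPRINT: Poisson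
majorant p414433, theta–Mellin p411028/p412019, zero-sum decay p413181, Rosser–Schoenfeld ψ <
1.03883x by name) + the data modules (≈ 0.45 s/row kernel MEASURED; this child ≈ 3 modules of ≈ 330
rows); closer per row through `SemilocalClassLaw.forall_prime_gt_lt_iff_upperClause`. Data: all 1
000 rows PASS `check` at J = 16 in the Python twin (THETA-KERNEL-QUOTE §1). RH-FREE finite
certificates. [deps: none] [difficulty: M] -/
@[route_item "route-RiemannHypothesis-WeilSemilocal"]
def WallsTenKNonTwin : Prop :=
  ∀ q : ℕ, q.Prime → 157 ≤ q → q < 10000 → ¬ (q + 2).Prime → ∀ q' : ℕ, q'.Prime → q < q' → Summit.RiemannHypothesis.RiemannHypothesis.Theorems.MotivicDoor.SemilocalThreshold.weilSemilocalThreshold (Nat.primesBelow q) < Real.log q' / 2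

-- `WallsTenKNonTwin` holds: proved by `Summit.RiemannHypothesis.RiemannHypothesis.Theorems.WeilSemilocalRoute.wallsTenKNonTwin_proof` (its module imports this route file, so no `_holds` link can be stated here).

-- parent: SemilocalWallsToTenThousand · glue (gen 1)
/--     item stmt-RiemannHypothesis-19174 · support · rank 303 · closed · proved by Summit.RiemannHypothesis.RiemannHypothesis.Theorems.WeilSemilocalRoute.wallsTenKGapSplit_proof (prover)
    parent: SemilocalWallsToTenThousand · GLUE: children ⟹ parent · by planner
WallsTenKNonTwin → WallsTenKTwin → SemilocalWallsToTenThousand — pure logic, excluded middle on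
`(q+2).Prime`: `fun hN hT q hq hlo hhi => (em (q + 2).Prime).elim (hT q hq hlo hhi) (hN q hq hlo
hhi)` (planner Sketch.lean `semilocalWallsToTenThousand_of_gapClass`, farm rc 0 / 0 sorries);
provable now by the first prover in one line. -/
@[route_item "route-RiemannHypothesis-WeilSemilocal"]
def WallsTenKGapSplit : Prop :=
  WallsTenKTwin → WallsTenKNonTwin → SemilocalWallsToTenThousand

-- `WallsTenKGapSplit` holds: proved by `Summit.RiemannHypothesis.RiemannHypothesis.Theorems.WeilSemilocalRoute.wallsTenKGapSplit_proof` (its module imports this route file, so no `_holds` link can be stated here).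

/-- item stmt-RiemannHypothesis-19394 · aside · rank 2 · closed · moot by None · by planner
why it might fail: parts (B),(D)–(G) of the explicit dodger (ATTEMPT-19 §8) are proved only for b = (log q)/2 − ε ≥ 100; at q ≈ 10⁴ (b ≈ 4.6) the zero-counting/Stirling margins may not close, and one prime pair in [10⁴, e^204) with δ*(q) > (7/100)(log q)^{3/2}q^{−3/2} refutes the ∃-statement.
sources: HasanalizadeShenWong2022, arXiv:2102.04663, Yoshida1992HermitianForms, ConnesConsani2023, arXiv:2106.01715, Bombieri2000Weil
[crux] the mollified zero-dodger zero-sum family at rate 7/100 from q₀ = 10⁴: for every pair of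
consecutive primes q < q' with q ≥ 10⁴ there is a Weil test function θ supported in [−(log q)/2,
(log q)/2], a shift 0 ≤ δ ≤ (7/100)(log q)^{3/2} q^{−3/2} with (log q)/2 + δ ≤ (log q')/2, and a
bound B of every truncated zero sum of the translate pair θ(·−δ) − θ(·+δ) strictly below the
weighted collar (2 log q/√q)·Re k_θ(log q − 2δ). PROVED from ⌈e^204⌉
(`Handoff.subwindowZeroSumFamily_exp204`); implied by the tree's typed claim
`Handoff.DodgerZeroSumClaim` (rate 1/50 from 10⁴; `dodgerFrom10k_of_claim` in the birth file).
[difficulty: XL] -/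
@[route_item "route-RiemannHypothesis-WeilSemilocal"]
def DodgerFamilyFromTenThousand : Prop :=
  Summit.RiemannHypothesis.RiemannHypothesis.Theorems.Handoff.SubwindowZeroSumFamily (7 / 100) 10000

/-- item stmt-RiemannHypothesis-19097 · support · rank 9 · closed · proved by Summit.RiemannHypothesis.RiemannHypothesis.Theorems.WeilSemilocalRoute.semilocalWallsFromSixtyThousand_proof (prover) · by planner
sources: arXiv:2102.04663, Yoshida1992HermitianForms
[support] C-I(a) at every prime q ≥ 60 000: for every prime q' > q, a*(S_q) < (log q')/2 — VERBATIM
the statement of `Handoff.classLaw_from_sixtyThousand` (Theorems/HandoffDodgerSmallCeiling.lean,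
p410077 PENDING; ATTEMPT-21: the mollified zero-dodger zero-sum family
`Handoff.SubwindowZeroSumFamily (1/5) 60000` gives UC(q) from 60 000 through its own window clause,
`subwindowWitnessFamily_of_zeroSumFamily` + `wallOffset_lt_of_translatePair`, no rate condition)
with q explicit; one-line closer `theorem … :
Summit.RiemannHypothesis.RiemannHypothesis.Theses.WeilSemilocal.SemilocalWallsFromSixtyThousand :=
fun q hq h => Handoff.classLaw_from_sixtyThousand hq h` the hour p410077 builds. [deps: none]
[difficulty: provable-now modulo p410077] -/
@[route_item "route-RiemannHypothesis-WeilSemilocal", crux]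
def SemilocalWallsFromSixtyThousand : Prop :=
  ∀ q : ℕ, q.Prime → 60000 ≤ q → ∀ q' : ℕ, q'.Prime → q < q' → Summit.RiemannHypothesis.RiemannHypothesis.Theorems.MotivicDoor.SemilocalThreshold.weilSemilocalThreshold (Nat.primesBelow q) < Real.log q' / 2

-- `SemilocalWallsFromSixtyThousand` holds: proved by `Summit.RiemannHypothesis.RiemannHypothesis.Theorems.WeilSemilocalRoute.semilocalWallsFromSixtyThousand_proof` (its module imports this route file, so no `_holds` link can be stated here).

/-- item stmt-RiemannHypothesis-19396 · support · rank 9 · closed · proved by Summit.RiemannHypothesis.RiemannHypothesis.Theorems.WeilSemilocalRoute.semilocalRowsToOneFiftySeven_proof (prover) · by planner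
sources: Yoshida1992HermitianForms, ConnesConsani2023
[support] C-I(a) at the fourteen primes 80 ≤ q < 157: rows q = 83, 89, 97, 107, 113, 127, 131, 139,
151 are landed kernel theorems
(`SemilocalPolyWitness.weilSemilocalThreshold_uptoSeventyNine_lt_log_eightyseven_half`,
`…uptoEightyThree_lt_log_ninetytwo_half`, `…uptoEightyNine_lt_log_hundredone_half`,
`…uptoHundredThree_lt_log_hundrednine_half`, `…uptoHundredNine_lt_log_hundredseventeen_half`,
`…uptoHundredThirteen_lt_log_hundredthirtyone_half`,
`…uptoHundredTwentySeven_lt_log_hundredthirtyseven_half`,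
`…uptoHundredThirtySeven_lt_log_hundredfortynine_half`,
`…uptoHundredFortyNine_lt_log_hundredfiftyseven_half`); rows 101, 103, 109, 137, 149 have landed
bases / pieces (`SemilocalNegCertUptoNinetySevenKinked*`, `…UptoHundredOne`, `…UptoHundredSeven`,
`…UptoHundredThirtyOneKinked*`, `…UptoHundredThirtyNineKinked`); packaging as cc-s2-1's
`semilocalClassLawBelow_137` pattern (`semilocalClassLawAt_of_eq` + `interval_cases`). [difficulty:
provable-now] -/
@[route_item "route-RiemannHypothesis-WeilSemilocal", crux]
def SemilocalRowsToOneFiftySeven : Prop :=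
  ∀ q : ℕ, q.Prime → 80 ≤ q → q < 157 → ∀ q' : ℕ, q'.Prime → q < q' → Summit.RiemannHypothesis.RiemannHypothesis.Theorems.MotivicDoor.SemilocalThreshold.weilSemilocalThreshold (Nat.primesBelow q) < Real.log q' / 2

-- `SemilocalRowsToOneFiftySeven` holds: proved by `Summit.RiemannHypothesis.RiemannHypothesis.Theorems.WeilSemilocalRoute.semilocalRowsToOneFiftySeven_proof` (its module imports this route file, so no `_holds` link can be stated here).

/-- item stmt-RiemannHypothesis-19397 · support · rank 9 · closed · proved by Summit.RiemannHypothesis.RiemannHypothesis.Theorems.WeilSemilocalRoute.semilocalClassLawHead_proof (prover) · by planner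
sources: Yoshida1992HermitianForms
[support] the kernel HEAD q < 80 — the head conjunct of `semilocalClassLawAll_iff_head_and_tail`
verbatim; PROVED as `SemilocalClassLaw.semilocalClassLawBelow_eighty : SemilocalClassLawBelow 80`
(p402719 + p405272; `SemilocalClassLawBelow 80` unfolds to this sentence), whose module has no hub
olean tonight — closed by the one-liner `fun q hq h ↦ semilocalClassLawBelow_eighty q hq h` the hour
it builds (recipe (b), cc-s2-1 I l.7206). [difficulty: provable-now] -/
@[route_item "route-RiemannHypothesis-WeilSemilocal", crux]
def SemilocalClassLawHead : Prop :=
  ∀ q : ℕ, q.Prime → q < 80 → ∀ q' : ℕ, q'.Prime → q < q' → Summit.RiemannHypothesis.RiemannHypothesis.Theorems.MotivicDoor.SemilocalThreshold.weilSemilocalThreshold (Nat.primesBelow q) < Real.log q' / 2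

-- `SemilocalClassLawHead` holds: proved by `Summit.RiemannHypothesis.RiemannHypothesis.Theorems.WeilSemilocalRoute.semilocalClassLawHead_proof` (its module imports this route file, so no `_holds` link can be stated here).

-- earlier Assembly (stmt-RiemannHypothesis-19398, replaced 2026-08-25T23:59:29Z -> stmt-RiemannHypothesis-19095): retired by None — SemilocalRowsToOneFiftySeven → SemilocalWallsToTenThousand → DodgerFamilyFromTenThousand → Summit.RiemannHypothesis.RiemannHypothesis.Theorems.SemilocalClassLaw.SemilocalClassLawTail
/-- item stmt-RiemannHypothesis-19095 · assembly · rank 1 · closed · proved by Summit.RiemannHypothesis.RiemannHypothesis.Theorems.WeilSemilocalRoute.assembly_proof (prover) · by planner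
sources: Yoshida1992HermitianForms, ConnesConsani2023
[assembly] HEAD → ROWS → WALLS-I → WALLS-II → TAIL → the leaf `SemilocalClassLawAll` — pure logic
(five-way case split on q; provable now, 12 lines in the planner's Sketch.lean); the deciding
theorem is `closes hA hH hR hW hM hT := hA hH hR hW hM hT`. -/
@[route_item "route-RiemannHypothesis-WeilSemilocal", crux]
def Assembly : Prop :=
  SemilocalClassLawHead → SemilocalRowsToOneFiftySeven → SemilocalWallsToTenThousand → SemilocalWallsToSixtyThousand → SemilocalWallsFromSixtyThousand → Summit.RiemannHypothesis.RiemannHypothesis.Theorems.SemilocalClassLaw.SemilocalClassLawAll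

-- `Assembly` holds: proved by `Summit.RiemannHypothesis.RiemannHypothesis.Theorems.WeilSemilocalRoute.assembly_proof` (its module imports this route file, so no `_holds` link can be stated here).

/-! D-0027 §2.1 — DECIDING THEOREM (planner-authored via `route open/edit --closes-file`; by planner-rh-explicit-weil-routes-1-g2-0 2026-08-25T23:59:29Z) — ARCHIVED: route closed (proved) 2026-08-26T23:00:00Z; kept so importers keep building:
its hypotheses are this route's items and its conclusion the registered leaf `Summit.RiemannHypothesis.RiemannHypothesis.Theorems.SemilocalClassLaw.SemilocalClassLawAll` (rung W-P(P2), D-0061) (glue_lint), and it elaborates with this file. -/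

@[closes "route-RiemannHypothesis-WeilSemilocal"] theorem closes (hA : Assembly) (hH : SemilocalClassLawHead) (hR : SemilocalRowsToOneFiftySeven)
    (hW : SemilocalWallsToTenThousand) (hM : SemilocalWallsToSixtyThousand)
    (hT : SemilocalWallsFromSixtyThousand) :
    Summit.RiemannHypothesis.RiemannHypothesis.Theorems.SemilocalClassLaw.SemilocalClassLawAll :=
  hA hH hR hW hM hT

end Summit.RiemannHypothesis.RiemannHypothesis.Theses.WeilSemilocal
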